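import Mathlib.Analysis.Complex.ExponentialBounds
import Summits.Ventures.WeilGRH.DualTrigCertMod25Class2One
import Summits.Ventures.WeilGRH.DualTrigCertMod25Class3One
import Summits.Ventures.WeilGRH.DualTrigCertMod25Class7One
import Summits.Ventures.WeilGRH.DualTrigCertMod25Class8One
import Summits.Ventures.WeilGRH.DualTrigCertMod25Class12One
import HarnessLib

/-!
# Every odd Dirichlet character mod 25: Weil positivity on `[−1, 1]`

Cell `rh-explicit`, WEIL TRACK — GRH ARM, route B (weil-grh-3, gen15).  Assembly (no kernel work) of the five format-D-K
window-`t = 1` instance files of the odd key classes of modulus 25 (`DualTrigCertMod25Class{2,3,7,8,12}One`: census classes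
`25.2/25.13` (`χ(2) = e(±1/20)`), `25.8/25.22` (`e(±3/20)`), `25.7/25.18` (`e(±1/4)`, the two odd characters induced from
conductor 5), `25.3/25.17` (`e(±7/20)`), `25.12/25.23` (`e(±9/20)`)).  Since `2` generates `(ℤ/25)ˣ`, `χ(2)²⁰ = 1`; for an odd
character `χ(2)¹⁰ = χ(−1) = −1`, so `χ(2) = e(k/20)` with `k` odd — exactly the ten certified characters.
Headline: `weilPositivityOnChar_mod25_one_of_odd` — for EVERY Dirichlet character `χ` mod 25 with `χ(−1) = −1` and every
smooth `g` supported in `[−1, 1]`, `Re W_χ(g ⋆ g̃) ≥ 0`.  Context: the arm's uniform `t = 1` floors cover every odd character of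
modulus `q ≥ 31` (`weilPositivityOnChar_one_of_odd_ge_31`) and of the moduli divisible by 2, 3, 6 from 14, 18, 12 on
(`UniformConductorFloorCoprimeFloors`); 25 is the largest modulus coprime to 6 below that floor.  Honest scope: a theorem for
these ten characters and this window only.  No named facts, no `sorry`; axioms standard.
-/

namespace Summit.Ventures.WeilGRH

open Literature.NumberTheory.LFunctions

/-- `exp (2πi/20)^k = exp (2πi·(k/20))`. [folklore] -/
theorem exp_twentieth_pow (k : ℕ) :
    Complex.exp (2 * Real.pi * Complex.I / 20) ^ k = Complex.exp (2 * Real.pi * Complex.I * ((k : ℂ) / 20)) := by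
  rw [← Complex.exp_nat_mul]; congr 1; ring

/-- **Every ODD Dirichlet character mod 25 satisfies Weil positivity on `[−1, 1]`.**  `2` generates `(ℤ/25)ˣ`, `χ(2)²⁰ = 1`
and `χ(2)¹⁰ = χ(−1) = −1`, so `χ(2) = e(k/20)` with `k` odd; `k = 1, 19` are the census classes `25.2`/`25.13`, `k = 3, 17`
are `25.8`/`25.22`, `k = 5, 15` are `25.7`/`25.18` (conductor 5), `k = 7, 13` are `25.3`/`25.17`, `k = 9, 11` are `25.12`/`25.23`
— ten kernel-certified characters, one per case. [folklore] -/
theorem weilPositivityOnChar_mod25_one_of_odd (χ : DirichletCharacter ℂ 25) (hχ : χ.Odd) :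
    WeilPositivityOnChar χ 1 := by
  have h20 : χ (2 : ZMod 25) ^ 20 = 1 := by
    rw [← map_pow, show (2 : ZMod 25) ^ 20 = 1 by decide, map_one]
  have h10 : χ (2 : ZMod 25) ^ 10 = -1 := by
    rw [← map_pow, show (2 : ZMod 25) ^ 10 = -1 by decide]; exact hχ
  have hprim : IsPrimitiveRoot (Complex.exp (2 * Real.pi * Complex.I / 20)) 20 :=
    Complex.isPrimitiveRoot_exp 20 (by norm_num)
  obtain ⟨k, hk, hζ⟩ := hprim.eq_pow_of_pow_eq_one h20
  rw [exp_twentieth_pow] at hζ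
  -- `χ(2) = e(k/20)`; the parity condition `e(k/20)^10 = e(k/2) = −1` kills the even `k`
  have hodd : ¬ (∃ j : ℕ, k = 2 * j) := by
    rintro ⟨j, rfl⟩
    have h1 : χ (2 : ZMod 25) ^ 10 = 1 := by
      rw [← hζ, ← Complex.exp_nat_mul, Complex.exp_eq_one_iff]
      exact ⟨(j : ℤ), by push_cast; ring⟩
    rw [h1] at h10
    norm_num at h10
  interval_cases k
  · exact absurd ⟨0, rfl⟩ hodd
  · exact weilPositivityOnChar_mod25_class2_one χ (by rw [← hζ]; push_cast; ring_nf)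
  · exact absurd ⟨1, rfl⟩ hodd
  · exact weilPositivityOnChar_mod25_class8_one χ (by rw [← hζ]; push_cast; ring_nf)
  · exact absurd ⟨2, rfl⟩ hodd
  · refine weilPositivityOnChar_mod25_class7_one χ ?_
    rw [← hζ, Complex.exp_eq_exp_iff_exists_int]
    exact ⟨0, by push_cast; ring⟩
  · exact absurd ⟨3, rfl⟩ hodd
  · exact weilPositivityOnChar_mod25_class3_one χ (by rw [← hζ]; push_cast; ring_nf)
  · exact absurd ⟨4, rfl⟩ hodd
  · exact weilPositivityOnChar_mod25_class12_one χ (by rw [← hζ]; push_cast; ring_nf)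
  · exact absurd ⟨5, rfl⟩ hodd
  · refine weilPositivityOnChar_mod25_class12_one_conj χ ?_
    rw [← hζ, Complex.exp_eq_exp_iff_exists_int]
    exact ⟨1, by push_cast; ring⟩
  · exact absurd ⟨6, rfl⟩ hodd
  · refine weilPositivityOnChar_mod25_class3_one_conj χ ?_
    rw [← hζ, Complex.exp_eq_exp_iff_exists_int]
    exact ⟨1, by push_cast; ring⟩
  · exact absurd ⟨7, rfl⟩ hodd
  · refine weilPositivityOnChar_mod25_class7_one_conj χ ?_
    rw [← hζ, Complex.exp_eq_exp_iff_exists_int]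
    exact ⟨1, by push_cast; ring⟩
  · exact absurd ⟨8, rfl⟩ hodd
  · refine weilPositivityOnChar_mod25_class8_one_conj χ ?_
    rw [← hζ, Complex.exp_eq_exp_iff_exists_int]
    exact ⟨1, by push_cast; ring⟩
  · exact absurd ⟨9, rfl⟩ hodd
  · refine weilPositivityOnChar_mod25_class2_one_conj χ ?_
    rw [← hζ, Complex.exp_eq_exp_iff_exists_int]
    exact ⟨1, by push_cast; ring⟩

/-- **Every odd Dirichlet character mod 25: Weil positivity on every window `[−t, t]`, `t ≤ 1`.** [folklore] -/
theorem weilPositivityOnChar_mod25_of_le_one_of_odd (χ : DirichletCharacter ℂ 25) (hχ : χ.Odd) {t : ℝ} (ht : t ≤ 1) :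
    WeilPositivityOnChar χ t :=
  (weilPositivityOnChar_mod25_one_of_odd χ hχ).mono ht

end Summit.Ventures.WeilGRH
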